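import Summits.BirchSwinnertonDyer.BirchSwinnertonDyer.Theorems.EdixhovenFibreFiveSevenStarredOptimalManinUnitFiveSevenTowerRangeAt
import Summits.BirchSwinnertonDyer.BirchSwinnertonDyer.Theorems.EdixhovenFibreFiveSevenStarredOptimalManinUnitFiveSevenSemiLocalIntegralityPinAt
import Literature.NumberTheory.EllipticCurves.DualExpEllipticReciprocityLaw
import HarnessLib

/-!
# [REC-tower] AT A TOWER `ℚ_v ⊆ L`, WEIL TOWER ALTERNATING ⟹ (S5b-tower) AT THAT TOWER — the `halt` twin of `…RecTowerAtBridge`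
# (route `EdixhovenFibreFiveSeven`, crux K★ stmt-BirchSwinnertonDyer-22226, line `kato-lever`; seat `bsd-line-edix-p1` g30, LEAD)

HONEST FRAMING. TOOL theorem only (no definition, no named fact, no `sorry`; file-local instance keys on `ℚ_v` byte-identical to
`…RecTowerAtBridge` l.66–70); nothing is closed; BSD / K★ are NOT proved by this.

WHY. Kato's formula is produced in the tree by the (K₂)^ram road (`TatePairingPointOfKTwo…`, `…TransportedReciprocityAllPoints`), whose Legendre
relation consumes the Weil-tower laws `healt` / `heL` / `henondeg` — all three derived from the LEVELWISE ALTERNATION `e_k(S, S) = 1`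
(`PAdicHodge.WeilTowerAlternating`, `PAdicHodge.WeilTowerNondegenerate`). The REC / LOC stubs of skeletons v7–v9 quantify over Weil towers with
six laws only (`hμ, hadd₁, hadd₂, hgal, hnondeg, hcompat` — the currency of `…RecTowerAtBridge.rangeAt_of_recTowerAt`, whose proof picks the tree
tower `exists_weilPairing_torsionMul_tower`), so alternation is not available to a stub prover. ★ `rangeAt_of_recTowerAtAlt` is the bridge twin whose
hypothesis quantifies only over ALTERNATING towers (extra binder `halt`), proved verbatim with the seven-law tower
`exists_weilPairing_torsionMul_tower_alt`; the cell closers and sockets on top (`…CellsOfRecTowerAtIntrinsicAlt`, `…RecTowerCellsOfLocalFormulaAlt`,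
skeleton v10) then hand `halt` to the stub provers.

References: [Kato1993LNM1553] Ch. II §1.2.4, Thm. 1.4.1 (3)–(4), Lemma 1.4.3–1.4.5; [BlochKato1990] Prop. 3.8, Ex. 3.11; [MilneADT2006] I §3 Cor. 3.4;
[SilvermanAEC2009] Prop. III.8.1.
-/


set_option autoImplicit false
-- the Theorems namespace of a single-conjunct summit repeats the summit name by design (D-0017)
set_option linter.dupNamespace false

noncomputable section

open scoped Classical MatrixGroups NumberField NNReal

open WeierstrassCurve NumberField IsDedekindDomain Field ValuativeRel
  Literature.NumberTheory.EllipticCurves Literature.NumberTheory.EllipticCurves.ModularForms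
  Literature.NumberTheory.EllipticCurves.Rank1Residual Literature.NumberTheory.EllipticCurves.Kato2004
  Literature.NumberTheory.DiophantineGeometry Rat.HeightOneSpectrum
  Literature.NumberTheory.PAdicHodge Literature.NumberTheory.GaloisRepresentations
  Literature.NumberTheory.GaloisRepresentations.IsNonarchimedeanLocalField
  Literature.NumberTheory.GaloisRepresentations.PeriodRingData
  Summit.BirchSwinnertonDyer.Rank1Residual Summit.BirchSwinnertonDyer.Rank1Residual.Additive
  Summit.BirchSwinnertonDyer.Rank1Residual.GaloisImage
  Summit.BirchSwinnertonDyer.BirchSwinnertonDyer.Theorems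
  Summit.BirchSwinnertonDyer.BirchSwinnertonDyer.Theorems.KimAtThreeDeepLowerExpStarOmega
  Summit.BirchSwinnertonDyer.BirchSwinnertonDyer.Theorems.KimAtThreeDeepLowerExpStarOmegaPlace
  Summit.BirchSwinnertonDyer.BirchSwinnertonDyer.Theorems.KimAtThreeDeepLowerExpStarOmegaRes
  Summit.BirchSwinnertonDyer.BirchSwinnertonDyer.Theorems.KimAtThreeDeepUpperExpStarTransport
  Summit.BirchSwinnertonDyer.BirchSwinnertonDyer.Theorems.KimAtThreeDeepUpperExpStarFacts
  Summit.BirchSwinnertonDyer.BirchSwinnertonDyer.Theorems.KimAtThreeDeepUpperExpStarFactsCanonical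
open Summit.BirchSwinnertonDyer.BirchSwinnertonDyer.Theorems.KimAtThreeDeepUpperTowerLattice (fact_natCast_mem_primesEquiv_symm)
open Literature.NumberTheory.EllipticCurves.FormalGroupChart (padicLogPointFiniteExt)
open CategoryTheory

namespace Summit.BirchSwinnertonDyer.BirchSwinnertonDyer.Theorems.StarredOptimalManinUnitFiveSevenRecTowerAtBridgeAlt

-- FILE-LOCAL instance keys, byte-identical to the accepted `…SemiLocalIntegralityPinAt.lean` l.164–169 (no library instance is
-- overridden outside this file): the `Fact (p ∈ v_p)` key and the local-field structures on `ℚ_v = Place.Completion (inr v)`, under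
-- which the bodies of (S5b-tower) / [REC-tower] at `ℚ_v ⊆ L` are stated.
attribute [local instance] fact_natCast_mem_primesEquiv_symm
attribute [local instance 100000] NumberField.Place.instAlgebraCompletion
attribute [local instance] valuativeRelPlace topologicalSpacePlace
attribute [local instance] isNonarchimedeanLocalField_place charZero_place
attribute [local instance] padicAlgebraPlace fact_not_isUnit_place isAdicComplete_place

/-! ## [REC-tower] with an ALTERNATING Weil tower at a tower ⟹ (S5b-tower) at that tower -/

section Bridge

variable (W : WeierstrassCurve ℚ) [W.IsElliptic] (p : ℕ) [Fact p.Prime]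
  (v : HeightOneSpectrum (𝓞 ℚ)) [hv : Fact (((p : ℕ) : 𝓞 ℚ) ∈ v.asIdeal)]
  {L : Type} [Field L] [ValuativeRel L] [TopologicalSpace L] [IsNonarchimedeanLocalField L]
  [CharZero L] [Algebra ℚ L] [Algebra (Place.Completion (Sum.inr v : Place ℚ)) L]
  [Fact (¬ IsUnit (p : integerC L))] [IsAdicComplete (Ideal.span {(p : integerC L)}) (integerC L)]
  (hL : valuation L p < 1) [Algebra ℚ_[p] L]

/-- ★ **[REC-tower] WITH ALTERNATING WEIL TOWER at the tower `ℚ_v ⊆ L` ⟹ (S5b-tower) at the tower `ℚ_v ⊆ L`** — verbatim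
`…RecTowerAtBridge.rangeAt_of_recTowerAt` except that the hypothesis quantifies only over Weil towers that are LEVELWISE ALTERNATING
(`e_k(S, S) = 1`, extra binder `_halt`), the tower used in the proof being `exists_weilPairing_torsionMul_tower_alt` (pointwise form of
`exists_smul_range_expStarCoord_tower_iff_trace_log_of_reciprocityLaw`, p700964). Hypothesis: the body of Kato's explicit reciprocity law
`tatePairingPoint_eq_trace_expStar_log_tower` at `K₀ = ℚ`, THIS `W`, `F₀ = ℚ_v`, `F = L` — for every Weil tower `e`, both line data `d₀`, `d`,
the Prop-1.2.3 binders and the compatibility clause, ONE `c ∈ ℚ_vˣ` with `⟨[η₀], P₀⟩ = Tr_{ℚ_v/ℚ_p}(c · exp*_{d₀}(η₀) · log_ω P₀)` and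
`⟨[η], P⟩ = Tr_{L/ℚ_p}(c · exp*_d(η) · log_ω P)`. Conclusion: the hypothesis `hT₂W` of `…TowerRangeAt.exists_smul_ranges_of_rangeAt` (ONE
rescaling `e` putting `range(exp*)` at both levels onto the trace dual of `log_ω E`). Proof: the Weil tower of `exists_weilPairing_torsionMul_tower`,
then `PAdicHodge.exists_smul_range_tower_of_reciprocity` with [TD] `exists_contOneCocycles_tatePairingPoint(Tower)_eq`, [N]
`eq_zero_of_forall_trace_mul_padicLog_baseChange_eq_zero`, [ADD] `padicLogPointFiniteExt_baseChange_add`.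
[cite: Kato1993LNM1553, Ch. II Thm. 1.4.1 (3)–(4) and §1.2.4] [cite: BlochKato1990, Prop. 3.8 (p. 354), Example 3.11 (p. 361)]
[cite: MilneADT2006, I §3 Cor. 3.4] -/
theorem rangeAt_of_recTowerAtAlt
    (hrec : ∀ (w₀ : Valuation (Place.Completion (Sum.inr v : Place ℚ)) ℝ≥0) [w₀.Compatible]
        [(W.baseChange (Place.Completion (Sum.inr v : Place ℚ))).IsIntegral w₀.integer]
        (ν : Valuation L ℝ≥0) [ν.Compatible] [(W.baseChange L).IsIntegral ν.integer]
        (e : (k : ℕ) → geomTorsion W ((p ^ k : ℕ) : ℤ) → geomTorsion W ((p ^ k : ℕ) : ℤ) → AlgebraicClosure ℚ)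
        (hμ : ∀ k S T, e k S T ^ (p ^ k) = 1)
        (hadd₁ : ∀ k S₁ S₂ T, e k (S₁ + S₂) T = e k S₁ T * e k S₂ T)
        (hadd₂ : ∀ k S T₁ T₂, e k S (T₁ + T₂) = e k S T₁ * e k S T₂)
        (hgal : ∀ k (σ : absoluteGaloisGroup ℚ) (S T : geomTorsion W ((p ^ k : ℕ) : ℤ)), σ • e k S T = e k (σ • S) (σ • T))
        (_hnondeg : ∀ k (T : geomTorsion W ((p ^ k : ℕ) : ℤ)), (∀ S, e k S T = 1) → T = 0)
        (_halt : ∀ k (S : geomTorsion W ((p ^ k : ℕ) : ℤ)), e k S S = 1)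
        (hcompat : ∀ k (S T : geomTorsion W ((p ^ (k + 1) : ℕ) : ℤ)),
          e k (torsionMulHom W (p ^ (k + 1)) (p ^ k) p (pow_succ p k).symm S)
            (torsionMulHom W (p ^ (k + 1)) (p ^ k) p (pow_succ p k).symm T) = e (k + 1) S T ^ p)
        (d₀ : LocalNeronLineAt W p v)
        (d : LocalNeronLine W hL ((galRestrictPlace v).comp
          (absGaloisRestrict (Place.Completion (Sum.inr v : Place ℚ)) L))),
        (bdRPeriodRingData (valuation_place_lt_one p v)).CupLogInjective (logCyclotomic p)
          (localRationalTateRep W p (galRestrictPlace v)) →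
        (∀ z : contOneCocycles (localRationalTateRep W p (galRestrictPlace v)).toTopRep,
          (bdRPeriodRingData (valuation_place_lt_one p v)).HasDualExp (logCyclotomic p)
            (localRationalTateRep W p (galRestrictPlace v)) fun σ => z.1 σ) →
        (bdRPeriodRingData (F := L) (p := p) hL).CupLogInjective (logCyclotomic p)
          (localRationalTateRep W p
            ((galRestrictPlace v).comp (absGaloisRestrict (Place.Completion (Sum.inr v : Place ℚ)) L))) →
        (∀ z : contOneCocycles (localRationalTateRep W p
            ((galRestrictPlace v).comp (absGaloisRestrict (Place.Completion (Sum.inr v : Place ℚ)) L))).toTopRep,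
          (bdRPeriodRingData (F := L) (p := p) hL).HasDualExp (logCyclotomic p)
            (localRationalTateRep W p
              ((galRestrictPlace v).comp (absGaloisRestrict (Place.Completion (Sum.inr v : Place ℚ)) L)))
            fun σ => z.1 σ) →
        (∀ (η₀ : contOneCocycles (restrictedTateRep W (Place.Completion (Sum.inr v : Place ℚ)) p).toTopRep)
            (ηT : contOneCocycles ((restrictedTateRep W (Place.Completion (Sum.inr v : Place ℚ)) p).restrict
              (absGaloisRestrict (Place.Completion (Sum.inr v : Place ℚ)) L)).toTopRep),
            (∀ σ, ηT.1 σ = η₀.1 (absGaloisRestrict (Place.Completion (Sum.inr v : Place ℚ)) L σ)) →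
            expStarCoordTower W (F₀ := Place.Completion (Sum.inr v : Place ℚ)) hL d ηT =
              algebraMap (Place.Completion (Sum.inr v : Place ℚ)) L
                (expStarCoord W (valuation_place_lt_one p v) d₀ η₀)) →
        ∃ c : (Place.Completion (Sum.inr v : Place ℚ)), c ≠ 0 ∧
          (∀ (η₀ : contOneCocycles (restrictedTateRep W (Place.Completion (Sum.inr v : Place ℚ)) p).toTopRep)
              (P : (W.baseChange (Place.Completion (Sum.inr v : Place ℚ))).toAffine.Point),
            ((tatePairingPoint W (Place.Completion (Sum.inr v : Place ℚ)) p e hμ hadd₁ hadd₂ hgal hcompat (oneCocycleClass _ η₀) P : ℤ_[p]) : ℚ_[p]) =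
              Algebra.trace ℚ_[p] (Place.Completion (Sum.inr v : Place ℚ))
                (c * expStarCoord W (valuation_place_lt_one p v) d₀ η₀ *
                  padicLogPointFiniteExt w₀ (W.baseChange (Place.Completion (Sum.inr v : Place ℚ))) p P)) ∧
          (∀ (ηT : contOneCocycles ((restrictedTateRep W (Place.Completion (Sum.inr v : Place ℚ)) p).restrict
                (absGaloisRestrict (Place.Completion (Sum.inr v : Place ℚ)) L)).toTopRep)
              (P : (W.baseChange L).toAffine.Point),
            ((tatePairingPointTower W (Place.Completion (Sum.inr v : Place ℚ)) e hμ hadd₁ hadd₂ hgal hcompat (oneCocycleClass _ ηT) P : ℤ_[p]) : ℚ_[p]) =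
              Algebra.trace ℚ_[p] L
                (algebraMap (Place.Completion (Sum.inr v : Place ℚ)) L c * expStarCoordTower W (F₀ := (Place.Completion (Sum.inr v : Place ℚ))) hL d ηT *
                  padicLogPointFiniteExt ν (W.baseChange L) p P))) :
    ∀ (w₀ : Valuation (Place.Completion (Sum.inr v : Place ℚ)) ℝ≥0) [w₀.Compatible]
        [(W.baseChange (Place.Completion (Sum.inr v : Place ℚ))).IsIntegral w₀.integer]
        (ν : Valuation L ℝ≥0) [ν.Compatible] [(W.baseChange L).IsIntegral ν.integer]
        (d₀ : LocalNeronLineAt W p v)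
        (d : LocalNeronLine W hL ((galRestrictPlace v).comp
          (absGaloisRestrict (Place.Completion (Sum.inr v : Place ℚ)) L))),
        (bdRPeriodRingData (valuation_place_lt_one p v)).CupLogInjective (logCyclotomic p)
          (localRationalTateRep W p (galRestrictPlace v)) →
        (∀ z : contOneCocycles (localRationalTateRep W p (galRestrictPlace v)).toTopRep,
          (bdRPeriodRingData (valuation_place_lt_one p v)).HasDualExp (logCyclotomic p)
            (localRationalTateRep W p (galRestrictPlace v)) fun σ => z.1 σ) →
        (bdRPeriodRingData (F := L) (p := p) hL).CupLogInjective (logCyclotomic p)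
          (localRationalTateRep W p
            ((galRestrictPlace v).comp (absGaloisRestrict (Place.Completion (Sum.inr v : Place ℚ)) L))) →
        (∀ z : contOneCocycles (localRationalTateRep W p
            ((galRestrictPlace v).comp (absGaloisRestrict (Place.Completion (Sum.inr v : Place ℚ)) L))).toTopRep,
          (bdRPeriodRingData (F := L) (p := p) hL).HasDualExp (logCyclotomic p)
            (localRationalTateRep W p
              ((galRestrictPlace v).comp (absGaloisRestrict (Place.Completion (Sum.inr v : Place ℚ)) L)))
            fun σ => z.1 σ) →
        (∀ (η₀ : contOneCocycles (restrictedTateRep W (Place.Completion (Sum.inr v : Place ℚ)) p).toTopRep)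
            (ηT : contOneCocycles ((restrictedTateRep W (Place.Completion (Sum.inr v : Place ℚ)) p).restrict
              (absGaloisRestrict (Place.Completion (Sum.inr v : Place ℚ)) L)).toTopRep),
            (∀ σ, ηT.1 σ = η₀.1 (absGaloisRestrict (Place.Completion (Sum.inr v : Place ℚ)) L σ)) →
            expStarCoordTower W (F₀ := Place.Completion (Sum.inr v : Place ℚ)) hL d ηT =
              algebraMap (Place.Completion (Sum.inr v : Place ℚ)) L
                (expStarCoord W (valuation_place_lt_one p v) d₀ η₀)) →
        ∃ (e : Place.Completion (Sum.inr v : Place ℚ)) (he : e ≠ 0),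
          (∀ a₀ : Place.Completion (Sum.inr v : Place ℚ),
            (∃ η₀ : contOneCocycles (restrictedTateRep W (Place.Completion (Sum.inr v : Place ℚ)) p).toTopRep,
                expStarCoord W (valuation_place_lt_one p v) (d₀.smul e he) η₀ = a₀) ↔
              ∀ P : (W.baseChange (Place.Completion (Sum.inr v : Place ℚ))).toAffine.Point,
                ‖Algebra.trace ℚ_[p] (Place.Completion (Sum.inr v : Place ℚ))
                    (a₀ * padicLogPointFiniteExt w₀
                      (W.baseChange (Place.Completion (Sum.inr v : Place ℚ))) p P)‖ ≤ 1) ∧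
          (∀ a : L,
            (∃ ηT : contOneCocycles ((restrictedTateRep W (Place.Completion (Sum.inr v : Place ℚ)) p).restrict
                (absGaloisRestrict (Place.Completion (Sum.inr v : Place ℚ)) L)).toTopRep,
                expStarCoordTower W (F₀ := Place.Completion (Sum.inr v : Place ℚ)) hL
                  (d.smul (algebraMap (Place.Completion (Sum.inr v : Place ℚ)) L e)
                    ((map_ne_zero (algebraMap (Place.Completion (Sum.inr v : Place ℚ)) L)).mpr he)) ηT = a) ↔
              ∀ P : (W.baseChange L).toAffine.Point,
                ‖Algebra.trace ℚ_[p] L (a * padicLogPointFiniteExt ν (W.baseChange L) p P)‖ ≤ 1) := by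
  intro w₀ _ _ ν _ _ d₀ d hcli₀ hde₀ hcli hde hcomp
  have hpQ : (p : ℚ) ≠ 0 := Nat.cast_ne_zero.mpr (Fact.out : p.Prime).ne_zero
  obtain ⟨e, hμ, hadd₁, hadd₂, hgal, hnondeg, halt, hcompat⟩ := WeierstrassCurve.exists_weilPairing_torsionMul_tower_alt W hpQ
  obtain ⟨c, hc, hrec₀, hrecF⟩ :=
    hrec w₀ ν e hμ hadd₁ hadd₂ hgal hnondeg halt hcompat d₀ d hcli₀ hde₀ hcli hde hcomp
  exact Literature.NumberTheory.PAdicHodge.exists_smul_range_tower_of_reciprocity W (valuation_place_lt_one p v) w₀ hL ν d₀ d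
    (fun η₀ P => tatePairingPoint W (Place.Completion (Sum.inr v : Place ℚ)) p e hμ hadd₁ hadd₂ hgal hcompat
      (oneCocycleClass _ η₀) P)
    (fun η P => tatePairingPointTower W (Place.Completion (Sum.inr v : Place ℚ)) e hμ hadd₁ hadd₂ hgal hcompat
      (oneCocycleClass _ η) P)
    c hc hrec₀ hrecF
    (exists_contOneCocycles_tatePairingPoint_eq W e hμ hadd₁ hadd₂ hgal hnondeg hcompat)
    (exists_contOneCocycles_tatePairingPointTower_eq W (Place.Completion (Sum.inr v : Place ℚ)) e hμ hadd₁ hadd₂ hgal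
      hnondeg hcompat)
    (fun _ hb => Literature.NumberTheory.PAdicHodge.eq_zero_of_forall_trace_mul_padicLog_baseChange_eq_zero W (valuation_place_lt_one p v) w₀ hb)
    (fun _ hb => Literature.NumberTheory.PAdicHodge.eq_zero_of_forall_trace_mul_padicLog_baseChange_eq_zero W hL ν hb)
    (FormalGroupChart.padicLogPointFiniteExt_baseChange_add W (valuation_place_lt_one p v) w₀)
    (FormalGroupChart.padicLogPointFiniteExt_baseChange_add W hL ν)

end Bridge

end Summit.BirchSwinnertonDyer.BirchSwinnertonDyer.Theorems.StarredOptimalManinUnitFiveSevenRecTowerAtBridgeAlt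

end
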